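import Summits.BirchSwinnertonDyer.BirchSwinnertonDyer.Theorems.KimAtThreeTwoExponentPortOfZetaBody
import Summits.BirchSwinnertonDyer.BirchSwinnertonDyer.Theorems.KimAtThreeShallowEqDeepOffStratumAdditiveDefectOfPort
import Summits.BirchSwinnertonDyer.BirchSwinnertonDyer.Theorems.KimAtThreeKolyvaginPortShared
import HarnessLib

/-!
# Route `KimAtThreeKolyvagin` (rung W2), crux `ShallowEqDeepOffKatoStratum` (item 19599): the registered stub
# `stub_additiveDefect` ⟸ crux 19560's THREE residual inputs in two-exponent form (+ the four PUBLISHED facts)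

Cell `bsd-addord`, seat `bsd-addord-w2-acc6` gen 2 (PROGRAMME PART 1b, plan g16 ACCEL-LIST (6)); `--supports`
stmt-BirchSwinnertonDyer-19599 (helper; the item OWNER assembles via
`Cruxes.ShallowEqDeepOffKatoStratum.Birth.ShallowEqDeepOffKatoStratum_of`).  Theorems only; nothing asserted,
nothing booked; crux 19599 stays OPEN.

## What

Gen 0 of this seat proved the 19599 stub VERBATIM from [S24] (1)(2), GZK, Poitou–Tate and ONE displayed object
PORT₂-on-the-defect-rows (`KimAtThreeShallowEqDeepOffStratumAdditiveDefectOfPort.stub_additiveDefect_of_portTwoExp`,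
p465715).  Gen 2's ★₂′ (`KimAtThreeTwoExponentPortOfZetaBody.katoKuriharaPortThreeAtWith₂TwoExp_zero_of_zetaBody_of_valueRows`)
discharges PORT₂ at one row from Kato's `ZetaBody`, the (Λ)-clauses + TWO-EXPONENT riders (ii₂), the auxiliary-datum
certificates and THEOREM D's `hbad`/`ht0`.  This file is the additive-defect TWIN of kim3 g10's
`KimAtThreeKolyvaginPortShared` (crux 19560 BY NAME from (C1) + (C2) + (C3)): it supplies gen 0's `hPort₂` — and hence
the stub — from the SAME three displayed residual inputs, restricted to the defect rows
(`Addv W 3`, tower, `#E(ℚ₃)[3] = 1`, `P` lattice-optimal at `N = N_W`, `3 ∣ c₃ ∨ 3 ∣ c_P`):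
* (C1₂) FINE KATO PACKAGE, two-exponent form — SOME Kato witnesses `(ι, κK, Λ)` of the `ZetaBody` family admit
  finite-level functionals `Λfin j` with DICT3's (Λ)-clauses and the two-exponent scalar compatibility (ii₂) for ONE
  exponent `e` (in print `e = v₃(c₃) + v₃(c_P)`: Kodaira IV/IV* lattice `exp*_ω(H¹(ℚ₃,T)) = 3^{v₃(c₃)−t}ℤ₃`, kim3
  Lemma L/L′; `‖Ω(W)/Ω⁺_{P.f}‖₃ = ‖c_P‖₃`), and `κK ∈ ℚ`, `v₃(κK) = 0`;
* (C2₂) CERTIFICATE SUPPLY — kim3's (C2) verbatim on the defect rows (Kato's auxiliary cusp datum with unit value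
  certificates; per-row decidable);
* (C3₂) ANOMALOUS ROWS — PORT₂ itself on the defect rows having a bad place `w ≠ 3` with `E(ℚ_w)[3] ≠ 0` (THEOREM D's
  `hbad`; kim3's (C3) shape).
Theorems: `portTwoExp_row_of_fineKato_of_certSupply_of_noAnomalous` (one row without anomalous bad place, from
(C1₂) + (C2₂); `ht0`, `9 ∣ N`, `Irr(E[3])`, the Tate-module binders discharged by kim3's §1 lemmas BY NAME),
`portTwoExp_rows_of_fineKato_of_certSupply_of_anomalousRows` (gen 0's `hPort₂` from (C1₂)+(C2₂)+(C3₂)), and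
**`stub_additiveDefect_of_fineKato_of_certSupply_of_anomalousRows`** — TYPE = the registered 19599 stub VERBATIM,
hypotheses EXACTLY: [S24] (1)(2), GZK, Poitou–Tate BY NAME, (C1₂), (C2₂), (C3₂).  So the additive-defect rows of 19599
carry NO debt beyond crux 19560's own residual triple (with ONE exponent `e` in ONE rider clause) + the route's PUB.

HONEST LIMITS: closes nothing ((C1₂) is construction-shaped over the tree, (C2₂) open class-wide, (C3₂) open in the
kernel); nothing is booked; no mark moves.  References: [Kato2004Asterisque] §8.1, Prop. 8.12, §9.4, Thm. 9.7, Thm.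
6.6 (1), Ex. 13.3; [Kim2022StructureSelmer] §3.2.3, Thm. 3.6, Thm. 3.13, §3.3; [MazurRubin2004] Thm. 3.2.4, App. A;
[Sakamoto2024] Thm. 4.4; [Kim2025RefinedTNC] Thm 1.1/1.2, §4.2, §8.1.2; [Rubin2000] Thm. 4.5.1; kim3 memo
KIM3-W2-PORT-g10; seat memos W2ACC6-TWOEXP-g0 / -g2.
-/

set_option autoImplicit false
-- the Theorems namespace of a single-conjunct summit repeats the summit name by design (D-0017)
set_option linter.dupNamespace false

noncomputable section

open scoped NumberField TensorProduct ContRepresentation Classical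
open Field Finset IsDedekindDomain NumberField WeierstrassCurve Rat.HeightOneSpectrum
open Literature.NumberTheory.GaloisRepresentations Literature.NumberTheory.GaloisCohomology
open Literature.NumberTheory.GaloisRepresentations.DiscreteGaloisModule
open Literature.NumberTheory.EllipticCurves Literature.NumberTheory.EllipticCurves.ModularForms
open Literature.NumberTheory.EllipticCurves.Rank1Residual
open Literature.NumberTheory.EllipticCurves.Kato2004
open Literature.NumberTheory.EllipticCurves.Kato2004.EulerSystemValues
open Summit.BirchSwinnertonDyer.Rank1Residual.GaloisImage
open Summit.BirchSwinnertonDyer.BirchSwinnertonDyer.Theorems.KimAtThreeKolyvaginDefs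
open Summit.BirchSwinnertonDyer.BirchSwinnertonDyer.Theorems.KimAtThreeTwoExponentPortOfZetaBody
open Summit.BirchSwinnertonDyer.BirchSwinnertonDyer.Theorems.KimAtThreeKolyvaginPortShared
open Summit.BirchSwinnertonDyer.BirchSwinnertonDyer.Theorems.KimAtThreeShallowEqDeepOffStratumAdditiveDefectOfPort

namespace Summit.BirchSwinnertonDyer.BirchSwinnertonDyer.Theorems.KimAtThreeShallowEqDeepOffStratumAdditiveDefectOfZetaBody

/-- Local notation: the TWO-EXPONENT rider clause (ii₂) at depth `j`, torsion exponent `t`, defect exponent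
`e`, place `v`, for the pair `(Λ, Λf)` (n1011's `KatoExpStarFiniteLevelAt` clause (ii), conclusion `× 3^e`). -/
local notation3 (prettyPrint := false) "RIDER₂⟦" W' ", " j ", " t' ", " e' ", " v' ", " Λ' ", " Λf "⟧" =>
  ∀ (r : Finset (HeightOneSpectrum (𝓞 ℚ)))
    (Ψ : H1 (tateRep W' 3) (cycSubgroup 3 0 r) →+
      continuousCohomology 1
        (subgroupRep (WeierstrassCurve.torsionGaloisModule W' (((3 : ℕ) : ℤ) ^ j * ((3 : ℕ) : ℤ))).toTopRep
          (cycSubgroup 3 0 r))),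
    (∀ (φ : contOneCocycles (subgroupRep (tateRep W' 3).toTopRep (cycSubgroup 3 0 r)))
        (ψ : contOneCocycles
          (subgroupRep (WeierstrassCurve.torsionGaloisModule W' (((3 : ℕ) : ℤ) ^ j * ((3 : ℕ) : ℤ))).toTopRep
            (cycSubgroup 3 0 r))),
        (∀ g, ((ψ.1 g : geomTorsion W' (((3 : ℕ) : ℤ) ^ j * ((3 : ℕ) : ℤ))) : geomPoints W') =
          TateModule.proj 3 (j + 1) (φ.1 g)) →
        Ψ (oneCocycleClass _ φ) = oneCocycleClass _ ψ) →
    ∀ (y : H1 (tateRep W' 3) (cycSubgroup 3 0 r))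
      (κ₀ : galoisCohomology (WeierstrassCurve.torsionGaloisModule W' (((3 : ℕ) : ℤ) ^ j * ((3 : ℕ) : ℤ))) 1)
      (s : ℤ_[3]),
      resSubgroup (WeierstrassCurve.torsionGaloisModule W' (((3 : ℕ) : ℤ) ^ j * ((3 : ℕ) : ℤ))).toTopRep
          (cycSubgroup 3 0 r) 1 κ₀ = Ψ y →
      galoisCohomology.localization (WeierstrassCurve.torsionGaloisModule W' (((3 : ℕ) : ℤ) ^ j * ((3 : ℕ) : ℤ)))
          (Sum.inr v') 1 κ₀ ∈ propagatedSelmerStructure W' 3 j (Sum.inr v') →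
      (∃ l ∈ cycIntLattice 3 (cycLevel 3 0 r),
          (((3 : ℕ) : ℤ_[3]) ^ t') • Λ' 0 r y - ((s : ℚ_[3]) ⊗ₜ[ℚ] (1 : CyclotomicField (cycLevel 3 0 r) ℚ)) =
            (((3 : ℕ) : ℤ_[3]) ^ (j + 1)) • (l : ℚ_[3] ⊗[ℚ] CyclotomicField (cycLevel 3 0 r) ℚ)) →
      ((3 ^ e' : ℕ) : ZMod (3 ^ (j + 1))) *
        Λf (galoisCohomology.localization
          (WeierstrassCurve.torsionGaloisModule W' (((3 : ℕ) : ℤ) ^ j * ((3 : ℕ) : ℤ))) (Sum.inr v') 1 κ₀) =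
        PadicInt.toZModPow (j + 1) s

/-- Local notation: **(C1₂) the FINE KATO PACKAGE in two-exponent form** on the additive-defect rows. -/
local notation3 (prettyPrint := false) "FINEKATO₂" =>
  ∀ (W : WeierstrassCurve ℚ) [W.IsElliptic] [W.IsGloballyMinimal]
    [ContinuousSMul ℤ_[3] (W.tateModule 3)] [Module.Free ℤ_[3] (W.tateModule 3)]
    [Module.Finite ℤ_[3] (W.tateModule 3)],
    (∀ m : ℕ, W.HasSurjectiveModNGaloisRep (3 ^ m : ℕ)) →
    (haveI : Fact (Nat.Prime 3) := ⟨Nat.prime_three⟩; Addv W 3) →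
    Nat.card {Q : (W.baseChange ℚ_[3]).toAffine.Point // (3 : ℕ) • Q = 0} = 1 →
    ∀ (v₃ : HeightOneSpectrum (𝓞 ℚ)), ((3 : ℕ) : 𝓞 ℚ) ∈ v₃.asIdeal →
    ∀ {N : ℕ} [NeZero N] (P : ModularParametrizationData W N), N = W.conductorNorm ℤ →
      (∀ z ∈ P.L.lattice, ∃ w ∈ periodLattice P.f, z = P.c * w) →
      (3 ∣ (W.baseChange ℚ_[3]).localTamagawaNumber ℤ_[3] ∨ (3 : ℤ) ∣ P.maninConstant) →
      ∃ (ι : (n : ℕ) → (CyclotomicField n ℚ →+* ℂ)) (κK : ℝ)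
        (Λ : ∀ (k' : ℕ) (r : Finset (HeightOneSpectrum (𝓞 ℚ))),
          H1 (tateRep W 3) (cycSubgroup 3 k' r) →ₗ[ℤ_[3]]
            ℚ_[3] ⊗[ℚ] CyclotomicField (cycLevel 3 k' r) ℚ)
        (Λfin : ∀ j : ℕ, galoisCohomology
          ((W.torsionGaloisModule (((3 : ℕ) : ℤ) ^ j * ((3 : ℕ) : ℤ))).toLocal (Sum.inr v₃)) 1 →+
            ZMod (3 ^ (j + 1))) (e : ℕ),
        κK ≠ 0 ∧ (∃ u : ℚ, (u : ℝ) = κK ∧ padicValRat 3 u = 0) ∧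
        (∀ j : ℕ,
          (∀ c : ZMod (3 ^ (j + 1)), ∃ x ∈ propagatedSelmerStructure W 3 j (Sum.inr v₃), Λfin j x = c) ∧
          (∀ x ∈ propagatedSelmerStructure W 3 j (Sum.inr v₃),
            Λfin j x = 0 ↔ x ∈ W.kummerSelmerStructure (((3 : ℕ) : ℤ) ^ j * ((3 : ℕ) : ℤ)) (Sum.inr v₃))) ∧
        (∀ j : ℕ, RIDER₂⟦W, j, 0, e, v₃, Λ, Λfin j⟧) ∧
        ∀ (c d a : ℤ) (A : ℕ), 0 < A → Int.gcd c (6 * 3 * A) = 1 → Int.gcd d (6 * 3 * N) = 1 →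
          ∃ (z : ∀ (k' : ℕ) (r : (cyclotomicLevelsRat 3 (badPlaces c d A N)).Ideals),
                H1 (tateRep W 3) ((cyclotomicLevelsRat 3 (badPlaces c d A N)).level k' r.1))
            (x : ∀ (k' : ℕ) (r : (cyclotomicLevelsRat 3 (badPlaces c d A N)).Ideals),
                CyclotomicField (cycLevel 3 k' r.1) ℚ),
            ZetaBody W 3 P.f ι κK Λ c d a A z x

/-- Local notation: **(C2₂) the CERTIFICATE SUPPLY** on the additive-defect rows (kim3's (C2) verbatim on them). -/
local notation3 (prettyPrint := false) "CERTSUPPLY₂" =>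
  ∀ (W : WeierstrassCurve ℚ) [W.IsElliptic] [W.IsGloballyMinimal],
    (∀ m : ℕ, W.HasSurjectiveModNGaloisRep (3 ^ m : ℕ)) →
    (haveI : Fact (Nat.Prime 3) := ⟨Nat.prime_three⟩; Addv W 3) →
    Nat.card {Q : (W.baseChange ℚ_[3]).toAffine.Point // (3 : ℕ) • Q = 0} = 1 →
    ∀ {N : ℕ} [NeZero N] (P : ModularParametrizationData W N), N = W.conductorNorm ℤ →
      (∀ z ∈ P.L.lattice, ∃ w ∈ periodLattice P.f, z = P.c * w) →
      (3 ∣ (W.baseChange ℚ_[3]).localTamagawaNumber ℤ_[3] ∨ (3 : ℤ) ∣ P.maninConstant) →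
      ∃ (c d a : ℤ) (A : ℕ) (d' : ℤ) (aM : ℕ → ℤ),
        0 < A ∧ Int.gcd c (6 * 3 * A) = 1 ∧ Int.gcd d (6 * 3 * N) = 1 ∧
        (∀ q : ℕ, q.Prime → q ≡ 1 [MOD 3] → ¬ q ∣ 2 * c.natAbs * d.natAbs * A) ∧
        Int.gcd (c * d) A = 1 ∧ d * d' ≡ 1 [ZMOD (A : ℤ)] ∧ Nat.Coprime A N ∧
        (∀ q ∈ (3 * A).primeFactors, cuspCoeff P.f q = aM q) ∧
        (∏ q ∈ (3 * A).primeFactors,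
            (1 - (aM q : ℚ) / q + (if q ∣ N then 0 else (1 / q : ℚ))) ≠ 0) ∧
        padicValRat 3 (∏ q ∈ (3 * A).primeFactors,
            (1 - (aM q : ℚ) / q + (if q ∣ N then 0 else (1 / q : ℚ)))) = 0 ∧
        ((c : ℚ) ^ 2 * (d : ℚ) ^ 2 * ratMinusSymbol P.f ((a : ℚ) / A) -
            (c : ℚ) * (d : ℚ) ^ 2 * ratMinusSymbol P.f ((a * c : ℚ) / A) -
            (c : ℚ) ^ 2 * (d : ℚ) * ratMinusSymbol P.f ((a * d' : ℚ) / A) +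
            (c : ℚ) * (d : ℚ) * ratMinusSymbol P.f ((a * c * d' : ℚ) / A) ≠ 0) ∧
        padicValRat 3 ((c : ℚ) ^ 2 * (d : ℚ) ^ 2 * ratMinusSymbol P.f ((a : ℚ) / A) -
            (c : ℚ) * (d : ℚ) ^ 2 * ratMinusSymbol P.f ((a * c : ℚ) / A) -
            (c : ℚ) ^ 2 * (d : ℚ) * ratMinusSymbol P.f ((a * d' : ℚ) / A) +
            (c : ℚ) * (d : ℚ) * ratMinusSymbol P.f ((a * c * d' : ℚ) / A)) = 0

/-- Local notation: **(C3₂) the ANOMALOUS ROWS** — PORT₂ on the additive-defect rows HAVING an anomalous bad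
place `w ≠ 3` (THEOREM D's `hbad` fails). -/
local notation3 (prettyPrint := false) "ANOMROWS₂" =>
  ∀ (W : WeierstrassCurve ℚ) [W.IsElliptic] [W.IsGloballyMinimal],
    (∀ m : ℕ, W.HasSurjectiveModNGaloisRep (3 ^ m : ℕ)) →
    (haveI : Fact (Nat.Prime 3) := ⟨Nat.prime_three⟩; Addv W 3) →
    Nat.card {Q : (W.baseChange ℚ_[3]).toAffine.Point // (3 : ℕ) • Q = 0} = 1 →
    ∀ (v₃ : HeightOneSpectrum (𝓞 ℚ)), ((3 : ℕ) : 𝓞 ℚ) ∈ v₃.asIdeal →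
    ∀ (η : (q : HeightOneSpectrum (𝓞 ℚ)) → (ZMod (Ideal.absNorm q.asIdeal))ˣ),
      (∀ q, Subgroup.zpowers (η q) = ⊤) →
    ∀ {N : ℕ} [NeZero N] (P : ModularParametrizationData W N), N = W.conductorNorm ℤ →
      (∀ z ∈ P.L.lattice, ∃ w ∈ periodLattice P.f, z = P.c * w) →
      (3 ∣ (W.baseChange ℚ_[3]).localTamagawaNumber ℤ_[3] ∨ (3 : ℤ) ∣ P.maninConstant) →
      (∃ w : HeightOneSpectrum (𝓞 ℚ), ¬ W.HasGoodReductionAt w ∧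
        ((primesEquiv w : Nat.Primes) : ℕ) ≠ 3 ∧
        ∃ Q : (W.baseChange (w.adicCompletion ℚ)).toAffine.Point, 3 • Q = 0 ∧ Q ≠ 0) →
      ∃ e : ℕ, KatoKuriharaPortThreeAtWith₂TwoExp W 0 e v₃ η P

/-! ### §1. PORT₂ at one additive-defect row WITHOUT an anomalous bad place, from (C1₂) + (C2₂) -/

/-- **PORT₂ at an additive-defect row without anomalous bad place `w ≠ 3`, from the FINE KATO PACKAGE (C1₂) and
the CERTIFICATE SUPPLY (C2₂)** — the defect-row binders (tower, `Addv W 3`, `#E(ℚ₃)[3] = 1`, `v₃ ∣ 3`, any `η`, `P`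
lattice-optimal at `N = N_W`, `3 ∣ c₃ ∨ 3 ∣ c_P`) plus THEOREM D's `hbad` give `∃ e, KatoKuriharaPortThreeAtWith₂TwoExp
W 0 e v₃ η P` by ★₂′ with `ht0`, `9 ∣ N`, `Irr(E[3])` and the Tate-module instance binders discharged (kim3 §1
lemmas by name).  (C1₂)/(C2₂) are displayed, crux-sized; nothing is booked.
[cite: Kato2004Asterisque, (8.1.3) (p. 180), Prop. 8.12 (p. 186), §9.4 and Thm. 9.7 (pp. 188–189), Thm. 6.6 (1) (p. 163), Ex. 13.3 (pp. 224–225)]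
[cite: Kim2022StructureSelmer, Thm. 3.13, §3.2.3 and §3.3–§3.4.1] [cite: MazurRubin2004, Thm. 3.2.4 and App. A]
[cite: Kim2025RefinedTNC, §4.2 and §8.1.2] -/
theorem portTwoExp_row_of_fineKato_of_certSupply_of_noAnomalous
    (hC1 : FINEKATO₂) (hC2 : CERTSUPPLY₂)
    (W : WeierstrassCurve ℚ) [W.IsElliptic] [W.IsGloballyMinimal]
    (htow : ∀ m : ℕ, W.HasSurjectiveModNGaloisRep (3 ^ m : ℕ))
    (hadd : haveI : Fact (Nat.Prime 3) := ⟨Nat.prime_three⟩; Addv W 3)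
    (ht : Nat.card {Q : (W.baseChange ℚ_[3]).toAffine.Point // (3 : ℕ) • Q = 0} = 1)
    (v₃ : HeightOneSpectrum (𝓞 ℚ)) (hv₃ : ((3 : ℕ) : 𝓞 ℚ) ∈ v₃.asIdeal)
    (η : (q : HeightOneSpectrum (𝓞 ℚ)) → (ZMod (Ideal.absNorm q.asIdeal))ˣ)
    {N : ℕ} [NeZero N] (P : ModularParametrizationData W N) (hN : N = W.conductorNorm ℤ)
    (hlat : ∀ z ∈ P.L.lattice, ∃ w ∈ periodLattice P.f, z = P.c * w)
    (hdef : 3 ∣ (W.baseChange ℚ_[3]).localTamagawaNumber ℤ_[3] ∨ (3 : ℤ) ∣ P.maninConstant)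
    -- the row has NO anomalous bad place `w ≠ 3` (THEOREM D's `hbad`)
    (hbad : ∀ w : HeightOneSpectrum (𝓞 ℚ), ¬ W.HasGoodReductionAt w →
      ((primesEquiv w : Nat.Primes) : ℕ) ≠ 3 →
        ∀ Q : (W.baseChange (w.adicCompletion ℚ)).toAffine.Point, 3 • Q = 0 → Q = 0) :
    ∃ e : ℕ, KatoKuriharaPortThreeAtWith₂TwoExp W 0 e v₃ η P := by
  haveI : Fact (Nat.Prime 3) := ⟨Nat.prime_three⟩
  haveI : ContinuousSMul ℤ_[3] (W.tateModule 3) := TateModule.continuousSMul_padicInt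
  haveI : Module.Free ℤ_[3] (W.tateModule 3) := W.module_free_tateModule_holds 3
  haveI : Module.Finite ℤ_[3] (W.tateModule 3) := W.module_finite_tateModule_holds 3
  obtain ⟨c, d, a, A, d', aM, hA, hcA, hdN, hcdA, hcd, hdd', hAN, haM, hE0, hE, hR0, hR⟩ :=
    hC2 W htow hadd ht P hN hlat hdef
  haveI : NeZero A := ⟨hA.ne'⟩
  obtain ⟨ι, κK, Λ, Λfin, e, hκ0, hNorm, hΛ, hfin₂, hz⟩ := hC1 W htow hadd ht v₃ hv₃ P hN hlat hdef
  obtain ⟨z, x, hbody⟩ := hz c d a A hA hcA hdN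
  have hirr : W.HasIrreducibleModPGaloisRep 3 := hasIrreducibleModPGaloisRep_three_of_tower W htow
  have hpN : 3 ^ 2 ∣ N := hN ▸ sq_dvd_conductorNorm_of_addv W hadd
  have ht0 : ∀ w : HeightOneSpectrum (𝓞 ℚ), ((3 : ℕ) : 𝓞 ℚ) ∈ w.asIdeal →
      ∀ Q : (W.baseChange (w.adicCompletion ℚ)).toAffine.Point, 3 • Q = 0 → Q = 0 :=
    fun w hw => forall_torsion_three_eq_zero_adicCompletion_of_natCard_eq_one W ht w hw
  exact ⟨e, katoKuriharaPortThreeAtWith₂TwoExp_zero_of_zetaBody_of_valueRows W P hN hbody Λfin hΛ hfin₂ hcdA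
    hbad ht0 hirr hNorm hκ0 d' hcd hdd' hAN hpN aM haM hE0 hE hR0 hR⟩

/-! ### §2. Gen 0's `hPort₂` (PORT₂ on EVERY additive-defect row) from (C1₂) + (C2₂) + (C3₂) -/

/-- **PORT₂-SHARED on the additive-defect rows — the displayed hypothesis `hPort₂` of gen 0's
`stub_additiveDefect_of_portTwoExp`, VERBATIM — from the three residual inputs (C1₂), (C2₂), (C3₂)**: split a row on
the existence of an anomalous bad place `w ≠ 3`; use (C3₂) there and
`portTwoExp_row_of_fineKato_of_certSupply_of_noAnomalous` elsewhere.  Crux 19560's shape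
(`KimAtThreeKolyvaginPortShared.katoKuriharaPortThreeShared_of_fineKato_of_certSupply_of_anomalousRows`) with the
defect selector `3 ∣ c₃ ∨ 3 ∣ c_P` and ONE exponent `e`.
[cite: Kato2004Asterisque, §9.4 and Thm. 9.7 (pp. 188–189), Ex. 13.3 (pp. 224–225)]
[cite: Kim2022StructureSelmer, Thm. 3.13 and §3.2.3] [cite: Rubin2000, Thm. 4.5.1] -/
theorem portTwoExp_rows_of_fineKato_of_certSupply_of_anomalousRows
    (hC1 : FINEKATO₂) (hC2 : CERTSUPPLY₂) (hC3 : ANOMROWS₂) :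
    ∀ (W : WeierstrassCurve ℚ) [W.IsElliptic] [W.IsGloballyMinimal],
      (∀ m : ℕ, W.HasSurjectiveModNGaloisRep (3 ^ m : ℕ)) →
      (haveI : Fact (Nat.Prime 3) := ⟨Nat.prime_three⟩; Addv W 3) →
      Nat.card {Q : (W.baseChange ℚ_[3]).toAffine.Point // (3 : ℕ) • Q = 0} = 1 →
      ∀ (v₃ : HeightOneSpectrum (𝓞 ℚ)), ((3 : ℕ) : 𝓞 ℚ) ∈ v₃.asIdeal →
      ∀ (η : (q : HeightOneSpectrum (𝓞 ℚ)) → (ZMod (Ideal.absNorm q.asIdeal))ˣ),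
        (∀ q, Subgroup.zpowers (η q) = ⊤) →
      ∀ {N : ℕ} [NeZero N] (P : ModularParametrizationData W N), N = W.conductorNorm ℤ →
        (∀ z ∈ P.L.lattice, ∃ w ∈ periodLattice P.f, z = P.c * w) →
        (3 ∣ (W.baseChange ℚ_[3]).localTamagawaNumber ℤ_[3] ∨ (3 : ℤ) ∣ P.maninConstant) →
          ∃ e : ℕ, KatoKuriharaPortThreeAtWith₂TwoExp W 0 e v₃ η P := by
  intro W _ _ htow hadd ht v₃ hv₃ η hη N _ P hN hlat hdef
  by_cases hanom : ∃ w : HeightOneSpectrum (𝓞 ℚ), ¬ W.HasGoodReductionAt w ∧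
      ((primesEquiv w : Nat.Primes) : ℕ) ≠ 3 ∧
      ∃ Q : (W.baseChange (w.adicCompletion ℚ)).toAffine.Point, 3 • Q = 0 ∧ Q ≠ 0
  · exact hC3 W htow hadd ht v₃ hv₃ η hη P hN hlat hdef hanom
  · push Not at hanom
    exact portTwoExp_row_of_fineKato_of_certSupply_of_noAnomalous hC1 hC2 W htow hadd ht v₃ hv₃ η P hN hlat
      hdef hanom

/-! ### §3. The registered stub of crux 19599 from (C1₂) + (C2₂) + (C3₂) + PUB -/

/-- **The registered stub `stub_additiveDefect` of crux 19599 (`ShallowEqDeepOffKatoStratum`) ⟸ [S24] (1)(2), GZK,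
Poitou–Tate BY NAME and crux 19560's three residual inputs in two-exponent form on the defect rows** — (C1₂) fine
Kato package (Kato's `ZetaBody` family for `P.f`, the conclusion of the PUBLISHED fact
`Kato2004.exists_eulerSystem_expStar_values`, WITH finite-level (Λ)-clauses + TWO-EXPONENT riders (ii₂) for one `e`
and the `3`-unit normalisation of Kato's constant), (C2₂) certificate supply, (C3₂) PORT₂ on the anomalous rows.
Proof: gen 0's `stub_additiveDefect_of_portTwoExp` ∘ `portTwoExp_rows_of_fineKato_of_certSupply_of_anomalousRows`.
TYPE of the conclusion = the 19599 stub VERBATIM (for the OWNER's `ShallowEqDeepOffKatoStratum_of`).  Nothing booked;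
19599 stays open.
[cite: Kim2025RefinedTNC, Thm 1.1, Thm 1.2, §4.2 and §8.1.2] [cite: Kim2022StructureSelmer, Thm. 1.9 (6), Thm. 3.13 and §3.2.3]
[cite: Kato2004Asterisque, (8.1.3) (p. 180), §9.4 and Thm. 9.7 (pp. 188–189), Ex. 13.3 (pp. 224–225)]
[cite: Sakamoto2024, Thm. 4.4 (p. 926)] [cite: MazurRubin2004, Thm. 5.2.12] [cite: MilneADT2006, Ch. I, Thm. 4.10] -/
theorem stub_additiveDefect_of_fineKato_of_certSupply_of_anomalousRows
    (hS24 : Sakamoto2024.kolyvaginSystems_freeRankOne_zmod_three_pow)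
    (hS24₂ : Sakamoto2024.kolyvaginSystems_idealOfBasis_eq_fittingIdeal_zmod_three_pow)
    (hGZK : rank_eq_analyticRank_of_analyticRank_le_one)
    (hPT : poitouTate_selmerStructure_duality ℚ)
    (hC1 : FINEKATO₂) (hC2 : CERTSUPPLY₂) (hC3 : ANOMROWS₂) :
    ∀ (W₀ : WeierstrassCurve ℚ) [W₀.IsElliptic] [W₀.IsGloballyMinimal],
      (∀ n : ℕ, W₀.HasSurjectiveModNGaloisRep (3 ^ n : ℕ)) →
      Nat.card {Q : (W₀.baseChange ℚ_[3]).toAffine.Point // (3 : ℕ) • Q = 0} = 1 → Finite W₀.sha →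
      ∀ {N : ℕ} [NeZero N], N = W₀.conductorNorm ℤ →
      ∀ (D₀ : Literature.NumberTheory.EllipticCurves.ModularForms.ModularParametrizationData W₀ N),
        (∀ z ∈ D₀.L.lattice, ∃ w ∈ Literature.NumberTheory.EllipticCurves.ModularForms.periodLattice D₀.f, z = D₀.c * w) →
        (∀ (W₂ : WeierstrassCurve ℚ) [W₂.IsElliptic]
          (D₂ : Literature.NumberTheory.EllipticCurves.ModularForms.ModularParametrizationData W₂ N),
          D₂.f = D₀.f → D₀.modularDegree ≤ D₂.modularDegree) →
        (∀ r : ℚ, Literature.NumberTheory.EllipticCurves.ratPlusSymbol D₀.f r ≠ 0 →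
          0 ≤ padicValRat 3 (Literature.NumberTheory.EllipticCurves.ratPlusSymbol D₀.f r)) →
        Literature.NumberTheory.EllipticCurves.kuriharaVanishingOrder W₀ 3 D₀.f = 0 →
        (haveI : Fact (Nat.Prime 3) := ⟨Nat.prime_three⟩;
            Literature.NumberTheory.EllipticCurves.Rank1Residual.Addv W₀ 3) →
        (3 ∣ (W₀.baseChange ℚ_[3]).localTamagawaNumber ℤ_[3] ∨ (3 : ℤ) ∣ D₀.maninConstant) →
        Literature.NumberTheory.EllipticCurves.kuriharaPartialDeepInfty W₀ 3 D₀.f ≤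
          Literature.NumberTheory.EllipticCurves.kuriharaPartialInfty W₀ 3 D₀.f :=
  stub_additiveDefect_of_portTwoExp hS24 hS24₂ hGZK hPT
    (portTwoExp_rows_of_fineKato_of_certSupply_of_anomalousRows hC1 hC2 hC3)

end Summit.BirchSwinnertonDyer.BirchSwinnertonDyer.Theorems.KimAtThreeShallowEqDeepOffStratumAdditiveDefectOfZetaBody

end
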